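import Summits.ABC.IUTFork.Joshi.ThetaLociPadicModel
import Summits.ABC.IUTFork.Joshi.Enlargements
import HarnessLib

/-!
# [J-III] Thm-Def 9.8.1.1 (7) «Θ̃^{Ĩ}_Joshi ⊂ Ĩ_Joshi», «Θ̃^{Ĩ}_Mochizuki ⊂ Ĩ_Mochizuki» DERIVED under the genuine
# convex-closure readings of the collation signature (proof-only companion of `Joshi/ThetaLociTensorPackets.lean`)

Block E (rung LADDER-ABC:A2.E) file of the abc-iut cell, seat abc-iut-E-t22 (slot T-22, [J-III] §9.8; authors-first
DERIVABLE row of the seat's own files). Source: K. Joshi, *Construction of Arithmetic Teichmüller Spaces III*,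
arXiv:2401.13508 **v4** («Preliminary version for comments», UNREFEREED; bib `Joshi2024ATS3`; rejected by the IUT author,
`Mochizuki2024JoshiReport`); render `HOME/lit/renders/Joshi-arxiv-2401.13508/pNNNN.txt`, «p.N l.M» = line M of page N.
**No side is taken** on [IUTchIII] Cor. 3.12, on Joshi's claims or on Mochizuki's report; typed ≠ proved ≠ endorsed.
PROOF-ONLY: no `def`, no instance, nothing asserted; every hypothesis is an explicit READING stated in the signature.

WHAT PRINT SAYS. Thm-Def 9.8.1.1 (4)/(5) (p.115 l.41 – p.116 l.9): `Θ̃^{Ĩ}_Joshi := Convex Closure of Ψ^{Joshi}_{Σ̃_{L′}}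
⊂ Ĩ_Joshi`, `Θ̃^{Ĩ}_Mochizuki := Convex Closure of Ψ^{Mochizuki}_{Σ̃_{L′}}`; (7) (p.116 l.25–50): `Θ̃^{Ĩ}_Joshi ⊂ Ĩ_Joshi ⊂
Ĩ^ℚ_Joshi` and «especially» `Θ̃^{Ĩ}_Mochizuki ⊂ Ĩ_Mochizuki ⊂ Ĩ^ℚ_Mochizuki`, with «Proof. The rest of the assertions are
easily assembled from already established facts and properties» (p.116 l.51–52). The established facts: the log-shell
`I((X/L_v, X^an/K_v)) = (1/p)·log(𝒪^*_{L_v})` «is the ℤ_p-module» of Def. 9.2.1.1 / (9.2.1.2) (p.96 l.35–50), hence CONVEX in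
the sense print uses — §9.10.8 p.126 l.3–4 «the notion of convex closure can be made in any Banach space [Schneider, 2002]»,
proof of Prop. 9.10.8.1 (1) p.126 l.19–21 «the hull is an ℤ_p-module. By the definition of convex subsets [Schneider, 2002,
Chap I, § 2], the hull is a convex subset as it is an ℤ_p-module»; and the convex closure is «the smallest, closed, convex
subset containing S» (§5.3.3 p.41 l.35–39) resp. the smallest convex one (§9.10.8).

WHAT THE SIGNATURE HAD. In `ATS3.TensorPacketLociDatum` (p428903) the two convex closures are ABSTRACT closure operators
`convJ`, `convM`, so (7) was typed as the READING PREDICATES `ShellsConvexStableJ/M` («the product of log-shells is stable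
under the convex closure») with `LocusInShellsJ/M`, Cor. 9.8.1.3 (`cor9813J/M`) and the tensor half of Cor. 9.8.2.6
(`tensorSize_bddAbove`, p429205) proved FROM them; the only realisation so far was the IDENTITY closure of the
non-vacuity model `padicLociModel` (p436602).

WHAT IS PROVED HERE (logic + linear algebra only). For any ring of scalars `O` acting on the coordinate spaces `V w`
(print: `O = ℤ_p`), under EITHER reading of the abstract closures —
(a) §9.10.8 algebraic: `convJ U = LogVol.convexClosure O U` (T-23's `Joshi/LogVolumesHulls.lean`, by name), or
(b) §5.3.3 topological: `convJ U = ATS3.closedConvexHull O U` (T-09's `Joshi/Enlargements.lean`, by name; Hausdorff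
coordinate spaces, so the compact shells are closed) —
and the reading «each log-shell `shell w` is convex» (`LogVol.IsConvexNA O`, i.e. `∅` or a coset of an `O`-submodule;
print: an `ℤ_p`-module): products of convex sets are convex (`isConvexNA_univ_pi`), so `Ĩ_Joshi`, `Ĩ_Mochizuki` are convex
(and closed); hence `ShellsConvexStableJ/M`, `LocusInShellsJ/M` = (7), Cor. 9.8.1.3 and Cor. 9.8.2.6 (tensor half) hold
modulo the convex reading ONLY; the loci `Θ̃^{Ĩ}` are themselves convex — cosets of an `O`-submodule through the standard
point's tuple `log_BK(ξ_{z_Θ})` — and, under (b), closed, hence COMPACT (a sharpening of Cor. 9.8.1.3's «contained in a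
compact subset»). NON-VACUITY: both readings are realisable on every module (`exists_closureOperator_*`), the unit ball
`ℤ_p ⊂ ℚ_p` (the shell of p436602) is convex over `ℤ_p` (`isConvexNA_padicIntBall`), and p436602's model with its identity
closures REPLACED by Joshi's convex closure satisfies every hypothesis of this file (`convexReading_nonvacuous`).
Which reading OUR side realises is the dictionary's business (E-PLAN R14: no Cor312*/Thm311* import here).
[claim: Joshi2024ATS3, status: disputed]
-/

noncomputable section

open Set Metric
open scoped Pointwise

namespace Summit.ABC.IUTFork.Joshi.ATS3

/-! ## 0. Non-archimedean convexity: products, the algebraic convex closure, closure operators -/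

section Convexity

variable (O : Type*) [CommRing O]

/-- The whole module is convex (`univ = 0 + ⊤`). [folklore] -/
theorem isConvexNA_univ {M : Type*} [AddCommGroup M] [Module O M] : LogVol.IsConvexNA O (univ : Set M) :=
  Or.inr ⟨0, ⊤, by ext x; simp⟩

/-- **A product of convex sets is convex** (in the product module): if every factor `t i` is `∅` or a coset `v_i + M_i`
of an `O`-submodule, then `∏_i t i` is `∅` (some factor empty) or the coset `v + ∏_i M_i`. [folklore] -/
theorem isConvexNA_univ_pi {ι : Type*} {X : ι → Type*} [∀ i, AddCommGroup (X i)] [∀ i, Module O (X i)]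
    {t : ∀ i, Set (X i)} (h : ∀ i, LogVol.IsConvexNA O (t i)) : LogVol.IsConvexNA O (Set.pi univ t) := by
  by_cases hne : ∀ i, (t i).Nonempty
  · have key : ∀ i, ∃ (v : X i) (N : Submodule O (X i)), t i = (fun m => v + m) '' (N : Set (X i)) := fun i => by
      rcases h i with h0 | h1
      · exact absurd h0 (hne i).ne_empty
      · exact h1
    choose v N hvN using key
    refine Or.inr ⟨v, Submodule.pi univ N, ?_⟩
    ext x
    rw [mem_univ_pi, mem_image]
    constructor
    · intro hx
      have hx' : ∀ i, ∃ m, m ∈ N i ∧ v i + m = x i := fun i => by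
        have hi := hx i
        rw [hvN i, mem_image] at hi
        obtain ⟨m, hm, hmx⟩ := hi
        exact ⟨m, hm, hmx⟩
      choose m hm hmx using hx'
      exact ⟨m, SetLike.mem_coe.2 (Submodule.mem_pi.2 fun i _ => hm i), funext fun i => hmx i⟩
    · rintro ⟨m, hm, rfl⟩ i
      rw [hvN i]
      exact ⟨m i, Submodule.mem_pi.1 (SetLike.mem_coe.1 hm) i (mem_univ i), rfl⟩
  · push Not at hne
    obtain ⟨i, hi⟩ := hne
    rw [Set.univ_pi_eq_empty hi]
    exact Or.inl rfl

/-- `U ⊆ conv(U)` for the algebraic convex closure of §9.10.8 (`LogVol.convexClosure`). [folklore] -/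
theorem subset_convexClosure {M : Type*} [AddCommGroup M] [Module O M] (U : Set M) :
    U ⊆ LogVol.convexClosure O U :=
  subset_sInter fun _ h => h.2

variable {O} in
/-- Minimality of the algebraic convex closure: every convex superset of `U` contains `conv(U)`. [folklore] -/
theorem convexClosure_minimal {M : Type*} [AddCommGroup M] [Module O M] {U C : Set M} (hUC : U ⊆ C)
    (hC : LogVol.IsConvexNA O C) : LogVol.convexClosure O U ⊆ C :=
  sInter_subset_of_mem ⟨hC, hUC⟩

/-- `conv(∅) = ∅`. [folklore] -/
theorem convexClosure_empty {M : Type*} [AddCommGroup M] [Module O M] :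
    LogVol.convexClosure O (∅ : Set M) = ∅ :=
  (convexClosure_minimal (empty_subset _) (Or.inl rfl)).antisymm (empty_subset _)

/-- **The algebraic convex closure is convex**: an intersection of cosets of submodules through a common point `s ∈ U` is
the coset of the intersection (the §9.10.8 twin of `isConvexNA_closedConvexHull`, §5.3.3). [folklore] -/
theorem isConvexNA_convexClosure {M : Type*} [AddCommGroup M] [Module O M] (U : Set M) :
    LogVol.IsConvexNA O (LogVol.convexClosure O U) := by
  rcases U.eq_empty_or_nonempty with rfl | ⟨s, hs⟩
  · rw [convexClosure_empty]; exact Or.inl rfl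
  · have key : ∀ A : {A : Set M // LogVol.IsConvexNA O A ∧ U ⊆ A},
        ∃ A₀ : Submodule O M, (A : Set M) = s +ᵥ (A₀ : Set M) :=
      fun A => exists_eq_vadd_of_isConvexNA A.2.1 (A.2.2 hs)
    choose N hN using key
    refine Or.inr ⟨s, ⨅ A, N A, ?_⟩
    rw [← vadd_coe_eq_image]
    ext x
    rw [mem_vadd_coe_iff, Submodule.mem_iInf, LogVol.convexClosure, mem_sInter]
    constructor
    · intro hx A
      have hxA := hx A A.2
      rwa [hN A, mem_vadd_coe_iff] at hxA
    · intro hx A hA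
      have hxA := hx ⟨A, hA⟩
      rw [← mem_vadd_coe_iff] at hxA
      rwa [show A = s +ᵥ ((N ⟨A, hA⟩ : Submodule O M) : Set M) from hN ⟨A, hA⟩]

/-- A convex set is its own algebraic convex closure (re-derived here from minimality; cf. T-23's
`LogVol.convexClosure_eq_self_of_isConvexNA`). [folklore] -/
theorem convexClosure_eq_of_isConvexNA {M : Type*} [AddCommGroup M] [Module O M] {C : Set M}
    (hC : LogVol.IsConvexNA O C) : LogVol.convexClosure O C = C :=
  (convexClosure_minimal subset_rfl hC).antisymm (subset_convexClosure O C)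

/-- **Reading (a) is realisable on every module**: the algebraic convex closure IS a Mathlib closure operator (extensive,
convex-valued, minimal), so an abstract `ClosureOperator (Set M)` field CAN be Joshi's §9.10.8 convex closure. [folklore] -/
theorem exists_closureOperator_convexClosure {M : Type*} [AddCommGroup M] [Module O M] :
    ∃ c : ClosureOperator (Set M), ∀ U, c U = LogVol.convexClosure O U :=
  ⟨ClosureOperator.ofPred (LogVol.convexClosure O) (LogVol.IsConvexNA O) (subset_convexClosure O)
      (isConvexNA_convexClosure O) (fun _ _ hUC hC => convexClosure_minimal hUC hC), fun _ => rfl⟩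

/-- **Reading (b) is realisable on every topological module**: the closed convex hull of §5.3.3 IS a closure operator
(T-09's `subset_closedConvexHull`, `isClosed_/isConvexNA_closedConvexHull`, `closedConvexHull_minimal`, by name; the same
packaging as T-09's `BEDatum.convBE`). [folklore] -/
theorem exists_closureOperator_closedConvexHull {M : Type*} [AddCommGroup M] [Module O M] [TopologicalSpace M] :
    ∃ c : ClosureOperator (Set M), ∀ U, c U = closedConvexHull O U :=
  ⟨ClosureOperator.ofPred (closedConvexHull O) (fun A => IsClosed A ∧ LogVol.IsConvexNA O A)
      (subset_closedConvexHull O) (fun S => ⟨isClosed_closedConvexHull O S, isConvexNA_closedConvexHull O S⟩)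
      (fun _ _ hST hT => closedConvexHull_minimal O hST hT.1 hT.2), fun _ => rfl⟩

/-- **The shell of the non-vacuity model p436602 is convex**: the unit ball `ℤ_p ⊂ ℚ_p` is the `ℤ_p`-submodule `1`
(print: the log-shell «is the ℤ_p-module …», (9.2.1.2) p.96 l.38–50). [folklore] -/
theorem isConvexNA_padicIntBall (p : ℕ) [Fact p.Prime] :
    LogVol.IsConvexNA ℤ_[p] (closedBall (0 : ℚ_[p]) 1) := by
  refine Or.inr ⟨0, 1, ?_⟩
  ext x
  simp only [mem_closedBall_zero_iff, mem_image, SetLike.mem_coe, Submodule.mem_one, zero_add, exists_exists_eq_and]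
  constructor
  · intro hx
    exact ⟨⟨x, hx⟩, rfl⟩
  · rintro ⟨y, rfl⟩
    exact y.2

end Convexity

/-! ## 1. The products of log-shells `Ĩ_Joshi`, `Ĩ_Mochizuki` are convex and closed -/

namespace TensorPacketLociDatum

variable {W : Type} {V : W → Type} [∀ w, TopologicalSpace (V w)] {TJ TM : Type} [TopologicalSpace TJ]
  [TopologicalSpace TM] (C : TensorPacketLociDatum W V TJ TM)
  (O : Type*) [CommRing O] [∀ w, AddCommGroup (V w)] [∀ w, Module O (V w)]

/-- `Ĩ_Joshi = ∏_j ∏_w shell w` is convex when every log-shell is (print: ℤ_p-modules). [folklore] -/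
theorem isConvexNA_shellsJ (hshell : ∀ w, LogVol.IsConvexNA O (C.shell w)) : LogVol.IsConvexNA O C.shellsJ := by
  unfold shellsJ
  exact isConvexNA_univ_pi O fun _ => isConvexNA_univ_pi O hshell

/-- `Ĩ_Mochizuki = ∏_j ∏_{a ∈ S_{j+1}} ∏_w shell w` is convex when every log-shell is. [folklore] -/
theorem isConvexNA_shellsM (hshell : ∀ w, LogVol.IsConvexNA O (C.shell w)) : LogVol.IsConvexNA O C.shellsM := by
  unfold shellsM
  exact isConvexNA_univ_pi O fun _ => isConvexNA_univ_pi O fun _ => isConvexNA_univ_pi O hshell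

omit [∀ w, AddCommGroup (V w)] [∀ w, Module O (V w)] in
/-- `Ĩ_Joshi` is closed for Hausdorff coordinate spaces (the shells are compact, `shell_compact`). [folklore] -/
theorem isClosed_shellsJ [∀ w, T2Space (V w)] : IsClosed C.shellsJ := by
  unfold shellsJ
  exact isClosed_set_pi fun _ _ => isClosed_set_pi fun w _ => (C.shell_compact w).isClosed

omit [∀ w, AddCommGroup (V w)] [∀ w, Module O (V w)] in
/-- `Ĩ_Mochizuki` is closed for Hausdorff coordinate spaces. [folklore] -/
theorem isClosed_shellsM [∀ w, T2Space (V w)] : IsClosed C.shellsM := by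
  unfold shellsM
  exact isClosed_set_pi fun _ _ => isClosed_set_pi fun _ _ => isClosed_set_pi fun w _ => (C.shell_compact w).isClosed

/-! ## 2. Reading (a): the abstract closures are the algebraic convex closure of §9.10.8 -/

section AlgebraicReading

variable (hconvJ : ∀ U : Set C.ProdJ, C.convJ U = LogVol.convexClosure O U)
  (hconvM : ∀ U : Set C.ProdM, C.convM U = LogVol.convexClosure O U)
  (hshell : ∀ w, LogVol.IsConvexNA O (C.shell w))

include hconvJ hshell in
/-- **`ShellsConvexStableJ` DERIVED** under reading (a): `conv(Ĩ_Joshi) ⊆ Ĩ_Joshi` since `Ĩ_Joshi` is convex. [folklore] -/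
theorem shellsConvexStableJ_of_convexClosureReading : C.ShellsConvexStableJ := by
  unfold ShellsConvexStableJ
  rw [hconvJ]
  exact convexClosure_minimal subset_rfl (C.isConvexNA_shellsJ O hshell)

include hconvM hshell in
/-- **`ShellsConvexStableM` DERIVED** under reading (a). [folklore] -/
theorem shellsConvexStableM_of_convexClosureReading : C.ShellsConvexStableM := by
  unfold ShellsConvexStableM
  rw [hconvM]
  exact convexClosure_minimal subset_rfl (C.isConvexNA_shellsM O hshell)

include hconvJ hconvM hshell in
/-- **Thm-Def 9.8.1.1 (7) DERIVED** under reading (a): `Θ̃^{Ĩ}_Joshi ⊂ Ĩ_Joshi` and `Θ̃^{Ĩ}_Mochizuki ⊂ Ĩ_Mochizuki`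
(`locusInShellsJ_of` / `locusInShellsM_of` of p428903, now with their hypothesis discharged). [claim: Joshi2024ATS3, status: disputed] -/
theorem locusInShells_of_convexClosureReading : C.LocusInShellsJ ∧ C.LocusInShellsM :=
  ⟨C.locusInShellsJ_of (C.shellsConvexStableJ_of_convexClosureReading O hconvJ hshell),
    C.locusInShellsM_of (C.shellsConvexStableM_of_convexClosureReading O hconvM hshell)⟩

include hconvJ hconvM hshell in
/-- **Cor. 9.8.1.3 DERIVED** under reading (a) (p.116 l.63 – p.117 l.6): both tensor loci lie in compact subsets, and so do
the product loci. [claim: Joshi2024ATS3, status: disputed] -/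
theorem cor9813_of_convexClosureReading :
    (∃ K : Set TJ, IsCompact K ∧ C.thetaLocusTensorJ ⊆ K) ∧ (∃ K : Set TM, IsCompact K ∧ C.thetaLocusTensorM ⊆ K) ∧
      (∃ K : Set C.ProdJ, IsCompact K ∧ C.thetaLocusProdJ ⊆ K) ∧ ∃ K : Set C.ProdM, IsCompact K ∧ C.thetaLocusProdM ⊆ K :=
  have h := C.locusInShells_of_convexClosureReading O hconvJ hconvM hshell
  ⟨C.cor9813J h.1, C.cor9813M h.2, (C.cor9813_prod h.1 h.2).1, (C.cor9813_prod h.1 h.2).2⟩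

include hconvJ hconvM hshell in
/-- **Cor. 9.8.2.6, tensor half, DERIVED** under reading (a) (p.117 l.127–158): the tensor-norm suprema `|Θ̃^{𝓘}_Joshi|`,
`|Θ̃^{𝓘}_Mochizuki|` are taken over bounded sets (`tensorSize_bddAbove` of p429205, hypothesis discharged). [claim: Joshi2024ATS3, status: disputed] -/
theorem tensorSize_bddAbove_of_convexClosureReading :
    BddAbove (C.tnrmJ '' C.thetaLocusTensorJ) ∧ BddAbove (C.tnrmM '' C.thetaLocusTensorM) :=
  have h := C.locusInShells_of_convexClosureReading O hconvJ hconvM hshell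
  C.tensorSize_bddAbove h.1 h.2

include hconvJ in
/-- Under reading (a) the locus `Θ̃^{Ĩ}_Joshi` is itself CONVEX (Thm-Def 9.8.1.1 (4): it IS a convex closure). [folklore] -/
theorem isConvexNA_thetaLocusProdJ_of_convexClosureReading : LogVol.IsConvexNA O C.thetaLocusProdJ := by
  unfold thetaLocusProdJ
  rw [hconvJ]
  exact isConvexNA_convexClosure O _

include hconvM in
/-- Under reading (a) the locus `Θ̃^{Ĩ}_Mochizuki` is convex (Thm-Def 9.8.1.1 (5)). [folklore] -/
theorem isConvexNA_thetaLocusProdM_of_convexClosureReading : LogVol.IsConvexNA O C.thetaLocusProdM := by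
  unfold thetaLocusProdM
  rw [hconvM]
  exact isConvexNA_convexClosure O _

include hconvJ in
/-- **Structure of the locus under reading (a)**: `Θ̃^{Ĩ}_Joshi` is the coset of ONE `O`-submodule of `Ĩ^ℚ_Joshi` through ANY
of its generating tuples — e.g. through the standard point's `log_BK(ξ^{Joshi}_{z_Θ})` (`psiJ_nonempty`, p428903). [folklore] -/
theorem thetaLocusProdJ_eq_vadd_of_convexClosureReading {x : C.ProdJ} (hx : x ∈ C.psiJ) :
    ∃ A₀ : Submodule O C.ProdJ, C.thetaLocusProdJ = x +ᵥ (A₀ : Set C.ProdJ) :=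
  exists_eq_vadd_of_isConvexNA (C.isConvexNA_thetaLocusProdJ_of_convexClosureReading O hconvJ)
    (C.psiJ_subset_thetaLocusProdJ hx)

end AlgebraicReading

/-! ## 3. Reading (b): the abstract closures are the closed convex hull of §5.3.3 (Hausdorff coordinate spaces) -/

section TopologicalReading

variable [∀ w, T2Space (V w)]
  (hconvJ : ∀ U : Set C.ProdJ, C.convJ U = closedConvexHull O U)
  (hconvM : ∀ U : Set C.ProdM, C.convM U = closedConvexHull O U)
  (hshell : ∀ w, LogVol.IsConvexNA O (C.shell w))

include hconvJ hshell in
/-- **`ShellsConvexStableJ` DERIVED** under reading (b): `Ĩ_Joshi` is closed and convex, so it contains the closed convex hull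
of itself. [folklore] -/
theorem shellsConvexStableJ_of_closedConvexHullReading : C.ShellsConvexStableJ := by
  unfold ShellsConvexStableJ
  rw [hconvJ]
  exact closedConvexHull_minimal O subset_rfl C.isClosed_shellsJ (C.isConvexNA_shellsJ O hshell)

include hconvM hshell in
/-- **`ShellsConvexStableM` DERIVED** under reading (b). [folklore] -/
theorem shellsConvexStableM_of_closedConvexHullReading : C.ShellsConvexStableM := by
  unfold ShellsConvexStableM
  rw [hconvM]
  exact closedConvexHull_minimal O subset_rfl C.isClosed_shellsM (C.isConvexNA_shellsM O hshell)

include hconvJ hconvM hshell in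
/-- **Thm-Def 9.8.1.1 (7) DERIVED** under reading (b). [claim: Joshi2024ATS3, status: disputed] -/
theorem locusInShells_of_closedConvexHullReading : C.LocusInShellsJ ∧ C.LocusInShellsM :=
  ⟨C.locusInShellsJ_of (C.shellsConvexStableJ_of_closedConvexHullReading O hconvJ hshell),
    C.locusInShellsM_of (C.shellsConvexStableM_of_closedConvexHullReading O hconvM hshell)⟩

include hconvJ hconvM hshell in
/-- **Cor. 9.8.2.6, tensor half, DERIVED** under reading (b). [claim: Joshi2024ATS3, status: disputed] -/
theorem tensorSize_bddAbove_of_closedConvexHullReading :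
    BddAbove (C.tnrmJ '' C.thetaLocusTensorJ) ∧ BddAbove (C.tnrmM '' C.thetaLocusTensorM) :=
  have h := C.locusInShells_of_closedConvexHullReading O hconvJ hconvM hshell
  C.tensorSize_bddAbove h.1 h.2

omit [∀ w, T2Space (V w)] in
include hconvJ in
/-- Under reading (b) the locus `Θ̃^{Ĩ}_Joshi` is CLOSED and CONVEX («this set is closed and convex», §5.3.3 p.41 l.37–38).
[folklore] -/
theorem isClosed_and_isConvexNA_thetaLocusProdJ_of_closedConvexHullReading :
    IsClosed C.thetaLocusProdJ ∧ LogVol.IsConvexNA O C.thetaLocusProdJ := by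
  unfold thetaLocusProdJ
  rw [hconvJ]
  exact ⟨isClosed_closedConvexHull O _, isConvexNA_closedConvexHull O _⟩

omit [∀ w, T2Space (V w)] in
include hconvM in
/-- Under reading (b) the locus `Θ̃^{Ĩ}_Mochizuki` is closed and convex. [folklore] -/
theorem isClosed_and_isConvexNA_thetaLocusProdM_of_closedConvexHullReading :
    IsClosed C.thetaLocusProdM ∧ LogVol.IsConvexNA O C.thetaLocusProdM := by
  unfold thetaLocusProdM
  rw [hconvM]
  exact ⟨isClosed_closedConvexHull O _, isConvexNA_closedConvexHull O _⟩

include hconvJ hconvM hshell in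
/-- **Cor. 9.8.1.3 SHARPENED under reading (b)**: the product loci are closed subsets of the compact `Ĩ`, hence themselves
COMPACT, and so are the tensor loci `Θ̃^{𝓘}` (continuous images) — print only asserts «contained in a compact subset»
(p.116 l.63–67). [claim: Joshi2024ATS3, status: disputed] -/
theorem isCompact_thetaLoci_of_closedConvexHullReading :
    IsCompact C.thetaLocusProdJ ∧ IsCompact C.thetaLocusProdM ∧
      IsCompact C.thetaLocusTensorJ ∧ IsCompact C.thetaLocusTensorM := by
  have h := C.locusInShells_of_closedConvexHullReading O hconvJ hconvM hshell
  have hJ : IsCompact C.thetaLocusProdJ := C.isCompact_shellsJ.of_isClosed_subset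
    (C.isClosed_and_isConvexNA_thetaLocusProdJ_of_closedConvexHullReading O hconvJ).1 h.1
  have hM : IsCompact C.thetaLocusProdM := C.isCompact_shellsM.of_isClosed_subset
    (C.isClosed_and_isConvexNA_thetaLocusProdM_of_closedConvexHullReading O hconvM).1 h.2
  exact ⟨hJ, hM, hJ.image C.toTensorJ_continuous, hM.image C.toTensorM_continuous⟩

omit [∀ w, T2Space (V w)] in
include hconvJ in
/-- Structure of the locus under reading (b): a closed coset of one `O`-submodule through any generating tuple. [folklore] -/
theorem thetaLocusProdJ_eq_vadd_of_closedConvexHullReading {x : C.ProdJ} (hx : x ∈ C.psiJ) :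
    ∃ A₀ : Submodule O C.ProdJ, C.thetaLocusProdJ = x +ᵥ (A₀ : Set C.ProdJ) :=
  exists_eq_vadd_of_isConvexNA (C.isClosed_and_isConvexNA_thetaLocusProdJ_of_closedConvexHullReading O hconvJ).2
    (C.psiJ_subset_thetaLocusProdJ hx)

end TopologicalReading

end TensorPacketLociDatum

/-! ## 4. Non-vacuity: p436602's `p`-adic model with Joshi's convex closure in place of the identity closures -/

/-- **The hypotheses of this file are jointly satisfiable on a genuine `p`-adic carrier**: replacing the two identity
closures of `padicLociModel p ℓ*` (p436602: `V = ℚ_p`, shell `ℤ_p`) by the algebraic convex closure over `O = ℤ_p` gives a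
collation signature satisfying reading (a) for both closures with convex shells; the same with the closed convex hull gives
reading (b). (A model exhibits satisfiability, nothing more.) [folklore] -/
theorem convexReading_nonvacuous (p : ℕ) [Fact p.Prime] (lstar : ℕ) :
    (∃ C : TensorPacketLociDatum Unit (fun _ => ℚ_[p]) (Fin lstar → Unit → ℚ_[p])
        (∀ i : Fin lstar, Fin ((i : ℕ) + 2) → Unit → ℚ_[p]),
      (∀ U, C.convJ U = LogVol.convexClosure ℤ_[p] U) ∧ (∀ U, C.convM U = LogVol.convexClosure ℤ_[p] U) ∧
        (∀ w, LogVol.IsConvexNA ℤ_[p] (C.shell w)) ∧ C.lstar = lstar) ∧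
    ∃ C : TensorPacketLociDatum Unit (fun _ => ℚ_[p]) (Fin lstar → Unit → ℚ_[p])
        (∀ i : Fin lstar, Fin ((i : ℕ) + 2) → Unit → ℚ_[p]),
      (∀ U, C.convJ U = closedConvexHull ℤ_[p] U) ∧ (∀ U, C.convM U = closedConvexHull ℤ_[p] U) ∧
        (∀ w, LogVol.IsConvexNA ℤ_[p] (C.shell w)) ∧ C.lstar = lstar := by
  obtain ⟨cJ, hcJ⟩ := exists_closureOperator_convexClosure ℤ_[p] (M := Fin lstar → Unit → ℚ_[p])
  obtain ⟨cM, hcM⟩ := exists_closureOperator_convexClosure ℤ_[p]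
    (M := ∀ i : Fin lstar, Fin ((i : ℕ) + 2) → Unit → ℚ_[p])
  obtain ⟨dJ, hdJ⟩ := exists_closureOperator_closedConvexHull ℤ_[p] (M := Fin lstar → Unit → ℚ_[p])
  obtain ⟨dM, hdM⟩ := exists_closureOperator_closedConvexHull ℤ_[p]
    (M := ∀ i : Fin lstar, Fin ((i : ℕ) + 2) → Unit → ℚ_[p])
  exact ⟨⟨{ padicLociModel p lstar with convJ := cJ, convM := cM }, hcJ, hcM, fun _ => isConvexNA_padicIntBall p, rfl⟩,
    ⟨{ padicLociModel p lstar with convJ := dJ, convM := dM }, hdJ, hdM, fun _ => isConvexNA_padicIntBall p, rfl⟩⟩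

end Summit.ABC.IUTFork.Joshi.ATS3

end
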